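import Mathlib
import Summits.Ventures.PercRepro2.Defs
import Summits.Ventures.PercRepro2.Independence
import Summits.Ventures.PercRepro2.Harris
import Summits.Ventures.PercRepro2.Graph
import Summits.Ventures.PercRepro2.Events
import Summits.Ventures.PercRepro2.Induced
import Summits.Ventures.PercRepro2.Frontier
import Summits.Ventures.PercRepro2.BTVFamilyDefs

/-!
# The merged V-family behind (B-T): revealing a frontier vertex of each cell
(blind cell PercRepro2, mine-1 g52; paper proofs/MINE1-BT.md §2.4 (F3))

For a vertex `z` of a frontier set of a cell, the cell on `G[U]` is, pointwise in the
configuration `ω`, the same cell on `G[U ∖ z]` with `z` replaced by its open neighbours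
`frontier ends U {z} ω` inside the frontier set that contained it (the pointwise domain Markov
identity of `Frontier.lean`, applied to every connection of the cell).  Eight lemmas: each of the
four cells, `z` a `u`-vertex or a `w`-vertex.
-/

namespace Summit.Ventures.PercRepro2

namespace BTVFamily

/-! ## Revealing a frontier vertex of each cell (the pointwise domain Markov identities) -/

section RevealCells

variable {V : Type*} {E : Type*} [Fintype E] [DecidableEq V] {ends : E → Sym2 V} {U : Finset V}
  {z : V} {ω : Config E}

omit [Fintype E] in
/-- `(B ∪ A) ∖ z ∪ F = B ∪ (A ∖ z ∪ F)` when `z ∉ B`. -/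
lemma erase_union_left {A B F : Finset V} (hzB : z ∉ B) :
    (B ∪ A).erase z ∪ F = B ∪ (A.erase z ∪ F) := by
  ext x
  have hB : x ∈ B → x ≠ z := fun h hx => hzB (hx ▸ h)
  simp only [Finset.mem_union, Finset.mem_erase]
  tauto

omit [Fintype E] in
/-- `(A ∪ B) ∖ z ∪ F = (A ∖ z ∪ F) ∪ B` when `z ∉ B`. -/
lemma erase_union_right {A B F : Finset V} (hzB : z ∉ B) :
    (A ∪ B).erase z ∪ F = (A.erase z ∪ F) ∪ B := by
  ext x
  have hB : x ∈ B → x ≠ z := fun h hx => hzB (hx ▸ h)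
  simp only [Finset.mem_union, Finset.mem_erase]
  tauto

omit [Fintype E] in
/-- `z ∉ {a} ∪ B` when `z ≠ a` and `z ∉ B`. -/
lemma not_mem_union_of_ne {a : V} {B : Finset V} (h : z ≠ a) (hB : z ∉ B) :
    z ∉ ({a} : Finset V) ∪ B := by
  simp only [Finset.mem_union, Finset.mem_singleton, not_or]
  exact ⟨h, hB⟩

variable (hzU : z ∈ U) {s t v : V} (hzs : z ≠ s) (hzt : z ≠ t) (hzv : z ≠ v)
include hzU hzs hzt hzv

omit hzv in
/-- Cell `a`, `z` a `u`-vertex. -/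
lemma aEv_reveal_A {A W : Finset V} (hzA : z ∈ A) (hzW : z ∉ W) :
    ω ∈ aEv ends U s t v A W ↔
      ω ∈ aEv ends (U \ {z}) s t v (A.erase z ∪ frontier ends U {z} ω) W := by
  have hzAW : z ∉ ({t} : Finset V) ∪ W := not_mem_union_of_ne hzt hzW
  have e3 : ConnSet ends (induced ends (↑U) ω) {s} ({t} ∪ A ∪ W) ↔
      ConnSet ends (induced ends (↑(U \ {z})) ω) {s}
        ({t} ∪ (A.erase z ∪ frontier ends U {z} ω) ∪ W) := by
    rw [connSet_reveal' hzU (by simpa using hzs)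
      (Finset.mem_union_left _ (Finset.mem_union_right _ hzA)),
      erase_union_right hzW, erase_union_left (by simpa using hzt)]
  have e4 : ConnSet ends (induced ends (↑U) ω) {t} A ↔
      ConnSet ends (induced ends (↑(U \ {z})) ω) {t} (A.erase z ∪ frontier ends U {z} ω) :=
    connSet_reveal' hzU (by simpa using hzt) hzA
  have e5 : ConnSet ends (induced ends (↑U) ω) W A ↔
      ConnSet ends (induced ends (↑(U \ {z})) ω) W (A.erase z ∪ frontier ends U {z} ω) :=
    connSet_reveal' hzU hzW hzA
  constructor
  · rintro ⟨h1, h2, h3, h4, h5⟩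
    have hsz : ¬ Conn ends (induced ends (↑U) ω) s z := fun h =>
      h3 ⟨s, Finset.mem_singleton_self s, z,
        Finset.mem_union_left _ (Finset.mem_union_right _ hzA), h⟩
    have htz : ¬ Conn ends (induced ends (↑U) ω) t z := fun h =>
      h4 ⟨t, Finset.mem_singleton_self t, z, hzA, h⟩
    refine ⟨?_, ?_, e3.not.1 h3, e4.not.1 h4, e5.not.1 h5⟩
    · exact conn_symm (conn_induced_sdiff_of_conn (Z := {z})
        (fun z' hz' => by rw [Finset.mem_singleton] at hz'; rw [hz']; exact hsz) (conn_symm h1))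
    · exact (connSet_sdiff_of_not_conn_z (z := z) fun x hx => by
        rw [Finset.mem_singleton] at hx; rw [hx]; exact htz).1 h2
  · rintro ⟨h1, h2, h3, h4, h5⟩
    exact ⟨conn_of_conn_sdiff h1, connSet_of_sdiff h2, e3.not.2 h3, e4.not.2 h4, e5.not.2 h5⟩

omit hzv in
/-- Cell `a`, `z` a `w`-vertex. -/
lemma aEv_reveal_W {A W : Finset V} (hzA : z ∉ A) (hzW : z ∈ W) :
    ω ∈ aEv ends U s t v A W ↔
      ω ∈ aEv ends (U \ {z}) s t v A (W.erase z ∪ frontier ends U {z} ω) := by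
  have hztA : z ∉ ({t} : Finset V) ∪ A := not_mem_union_of_ne hzt hzA
  have e2 : ConnSet ends (induced ends (↑U) ω) {t} W ↔
      ConnSet ends (induced ends (↑(U \ {z})) ω) {t} (W.erase z ∪ frontier ends U {z} ω) :=
    connSet_reveal' hzU (by simpa using hzt) hzW
  have e3 : ConnSet ends (induced ends (↑U) ω) {s} ({t} ∪ A ∪ W) ↔
      ConnSet ends (induced ends (↑(U \ {z})) ω) {s}
        ({t} ∪ A ∪ (W.erase z ∪ frontier ends U {z} ω)) := by
    rw [connSet_reveal' hzU (by simpa using hzs) (Finset.mem_union_right _ hzW),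
      erase_union_left hztA]
  have e5 : ConnSet ends (induced ends (↑U) ω) W A ↔
      ConnSet ends (induced ends (↑(U \ {z})) ω) (W.erase z ∪ frontier ends U {z} ω) A :=
    connSet_reveal hzU hzW hzA
  constructor
  · rintro ⟨h1, h2, h3, h4, h5⟩
    have hsz : ¬ Conn ends (induced ends (↑U) ω) s z := fun h =>
      h3 ⟨s, Finset.mem_singleton_self s, z, Finset.mem_union_right _ hzW, h⟩
    refine ⟨?_, e2.1 h2, e3.not.1 h3, fun hc => h4 (connSet_of_sdiff hc), e5.not.1 h5⟩
    exact conn_symm (conn_induced_sdiff_of_conn (Z := {z})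
      (fun z' hz' => by rw [Finset.mem_singleton] at hz'; rw [hz']; exact hsz) (conn_symm h1))
  · rintro ⟨h1, h2, h3, h4, h5⟩
    refine ⟨conn_of_conn_sdiff h1, e2.2 h2, e3.not.2 h3, ?_, e5.not.2 h5⟩
    rintro ⟨t', ht', a, ha, hta⟩
    rw [Finset.mem_singleton] at ht'
    subst ht'
    rcases conn_sdiff_or_conn_z (z := z) hta with h | h
    · exact h4 ⟨t', Finset.mem_singleton_self t', a, ha, h⟩
    · exact (e5.not.2 h5) ⟨z, hzW, a, ha, conn_trans (conn_symm h) hta⟩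

omit hzv in
/-- Cell `b`, `z` a `u`-vertex. -/
lemma bEv_reveal_A {A W : Finset V} (hzA : z ∈ A) (hzW : z ∉ W) :
    ω ∈ bEv ends U s t v A W ↔
      ω ∈ bEv ends (U \ {z}) s t v (A.erase z ∪ frontier ends U {z} ω) W := by
  have e2 : ConnSet ends (induced ends (↑U) ω) {s} A ↔
      ConnSet ends (induced ends (↑(U \ {z})) ω) {s} (A.erase z ∪ frontier ends U {z} ω) :=
    connSet_reveal' hzU (by simpa using hzs) hzA
  have e3 : ConnSet ends (induced ends (↑U) ω) {t} ({s} ∪ A ∪ W) ↔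
      ConnSet ends (induced ends (↑(U \ {z})) ω) {t}
        ({s} ∪ (A.erase z ∪ frontier ends U {z} ω) ∪ W) := by
    rw [connSet_reveal' hzU (by simpa using hzt)
      (Finset.mem_union_left _ (Finset.mem_union_right _ hzA)),
      erase_union_right hzW, erase_union_left (by simpa using hzs)]
  have e5 : ConnSet ends (induced ends (↑U) ω) A W ↔
      ConnSet ends (induced ends (↑(U \ {z})) ω) (A.erase z ∪ frontier ends U {z} ω) W :=
    connSet_reveal hzU hzA hzW
  constructor
  · rintro ⟨h1, h2, h3, h4, h5⟩
    have htz : ¬ Conn ends (induced ends (↑U) ω) t z := fun h =>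
      h3 ⟨t, Finset.mem_singleton_self t, z,
        Finset.mem_union_left _ (Finset.mem_union_right _ hzA), h⟩
    refine ⟨?_, e2.1 h2, e3.not.1 h3, fun hc => h4 (connSet_of_sdiff hc), e5.not.1 h5⟩
    exact conn_symm (conn_induced_sdiff_of_conn (Z := {z})
      (fun z' hz' => by rw [Finset.mem_singleton] at hz'; rw [hz']; exact htz) (conn_symm h1))
  · rintro ⟨h1, h2, h3, h4, h5⟩
    refine ⟨conn_of_conn_sdiff h1, e2.2 h2, e3.not.2 h3, ?_, e5.not.2 h5⟩
    rintro ⟨s', hs', w', hw', hsw⟩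
    rw [Finset.mem_singleton] at hs'
    subst hs'
    rcases conn_sdiff_or_conn_z (z := z) hsw with h | h
    · exact h4 ⟨s', Finset.mem_singleton_self s', w', hw', h⟩
    · exact (e5.not.2 h5) ⟨z, hzA, w', hw', conn_trans (conn_symm h) hsw⟩

omit hzv in
/-- Cell `b`, `z` a `w`-vertex. -/
lemma bEv_reveal_W {A W : Finset V} (hzA : z ∉ A) (hzW : z ∈ W) :
    ω ∈ bEv ends U s t v A W ↔
      ω ∈ bEv ends (U \ {z}) s t v A (W.erase z ∪ frontier ends U {z} ω) := by
  have hzsA : z ∉ ({s} : Finset V) ∪ A := not_mem_union_of_ne hzs hzA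
  have e3 : ConnSet ends (induced ends (↑U) ω) {t} ({s} ∪ A ∪ W) ↔
      ConnSet ends (induced ends (↑(U \ {z})) ω) {t}
        ({s} ∪ A ∪ (W.erase z ∪ frontier ends U {z} ω)) := by
    rw [connSet_reveal' hzU (by simpa using hzt) (Finset.mem_union_right _ hzW),
      erase_union_left hzsA]
  have e4 : ConnSet ends (induced ends (↑U) ω) {s} W ↔
      ConnSet ends (induced ends (↑(U \ {z})) ω) {s} (W.erase z ∪ frontier ends U {z} ω) :=
    connSet_reveal' hzU (by simpa using hzs) hzW
  have e5 : ConnSet ends (induced ends (↑U) ω) A W ↔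
      ConnSet ends (induced ends (↑(U \ {z})) ω) A (W.erase z ∪ frontier ends U {z} ω) :=
    connSet_reveal' hzU hzA hzW
  constructor
  · rintro ⟨h1, h2, h3, h4, h5⟩
    have htz : ¬ Conn ends (induced ends (↑U) ω) t z := fun h =>
      h3 ⟨t, Finset.mem_singleton_self t, z, Finset.mem_union_right _ hzW, h⟩
    have hsz : ¬ Conn ends (induced ends (↑U) ω) s z := fun h =>
      h4 ⟨s, Finset.mem_singleton_self s, z, hzW, h⟩
    refine ⟨?_, ?_, e3.not.1 h3, e4.not.1 h4, e5.not.1 h5⟩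
    · exact conn_symm (conn_induced_sdiff_of_conn (Z := {z})
        (fun z' hz' => by rw [Finset.mem_singleton] at hz'; rw [hz']; exact htz) (conn_symm h1))
    · exact (connSet_sdiff_of_not_conn_z (z := z) fun x hx => by
        rw [Finset.mem_singleton] at hx; rw [hx]; exact hsz).1 h2
  · rintro ⟨h1, h2, h3, h4, h5⟩
    exact ⟨conn_of_conn_sdiff h1, connSet_of_sdiff h2, e3.not.2 h3, e4.not.2 h4, e5.not.2 h5⟩

/-- Cell `j`, `z` a `u`-vertex. -/
lemma jEv_reveal_A {A W : Finset V} (hzA : z ∈ A) (hzW : z ∉ W) :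
    ω ∈ jEv ends U s t v A W ↔
      ω ∈ jEv ends (U \ {z}) s t v (A.erase z ∪ frontier ends U {z} ω) W := by
  have e1 : ConnSet ends (induced ends (↑U) ω) {s} A ↔
      ConnSet ends (induced ends (↑(U \ {z})) ω) {s} (A.erase z ∪ frontier ends U {z} ω) :=
    connSet_reveal' hzU (by simpa using hzs) hzA
  have e2 : ConnSet ends (induced ends (↑U) ω) {v} ({s} ∪ A) ↔
      ConnSet ends (induced ends (↑(U \ {z})) ω) {v}
        ({s} ∪ (A.erase z ∪ frontier ends U {z} ω)) := by
    rw [connSet_reveal' hzU (by simpa using hzv) (Finset.mem_union_right _ hzA),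
      erase_union_left (by simpa using hzs)]
  have e3 : ConnSet ends (induced ends (↑U) ω) {t} ({s} ∪ A ∪ W) ↔
      ConnSet ends (induced ends (↑(U \ {z})) ω) {t}
        ({s} ∪ (A.erase z ∪ frontier ends U {z} ω) ∪ W) := by
    rw [connSet_reveal' hzU (by simpa using hzt)
      (Finset.mem_union_left _ (Finset.mem_union_right _ hzA)),
      erase_union_right hzW, erase_union_left (by simpa using hzs)]
  have e4 : ConnSet ends (induced ends (↑U) ω) ({s} ∪ A) W ↔
      ConnSet ends (induced ends (↑(U \ {z})) ω)
        ({s} ∪ (A.erase z ∪ frontier ends U {z} ω)) W := by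
    rw [connSet_reveal hzU (Finset.mem_union_right _ hzA) hzW,
      erase_union_left (by simpa using hzs)]
  constructor
  · rintro ⟨h1, h2, h3, h4⟩
    exact ⟨e1.1 h1, e2.1 h2, e3.not.1 h3, e4.not.1 h4⟩
  · rintro ⟨h1, h2, h3, h4⟩
    exact ⟨e1.2 h1, e2.2 h2, e3.not.2 h3, e4.not.2 h4⟩

/-- Cell `j`, `z` a `w`-vertex. -/
lemma jEv_reveal_W {A W : Finset V} (hzA : z ∉ A) (hzW : z ∈ W) :
    ω ∈ jEv ends U s t v A W ↔
      ω ∈ jEv ends (U \ {z}) s t v A (W.erase z ∪ frontier ends U {z} ω) := by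
  have hzsA : z ∉ ({s} : Finset V) ∪ A := not_mem_union_of_ne hzs hzA
  have e3 : ConnSet ends (induced ends (↑U) ω) {t} ({s} ∪ A ∪ W) ↔
      ConnSet ends (induced ends (↑(U \ {z})) ω) {t}
        ({s} ∪ A ∪ (W.erase z ∪ frontier ends U {z} ω)) := by
    rw [connSet_reveal' hzU (by simpa using hzt) (Finset.mem_union_right _ hzW),
      erase_union_left hzsA]
  have e4 : ConnSet ends (induced ends (↑U) ω) ({s} ∪ A) W ↔
      ConnSet ends (induced ends (↑(U \ {z})) ω) ({s} ∪ A)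
        (W.erase z ∪ frontier ends U {z} ω) :=
    connSet_reveal' hzU hzsA hzW
  constructor
  · rintro ⟨h1, h2, h3, h4⟩
    have hsz : ¬ Conn ends (induced ends (↑U) ω) s z := fun h =>
      h4 ⟨s, Finset.mem_union_left _ (Finset.mem_singleton_self s), z, hzW, h⟩
    refine ⟨(connSet_sdiff_of_not_conn_z (z := z) fun x hx => by
        rw [Finset.mem_singleton] at hx; rw [hx]; exact hsz).1 h1, ?_, e3.not.1 h3, e4.not.1 h4⟩
    obtain ⟨v', hv', x, hx, hvx⟩ := h2
    rw [Finset.mem_singleton] at hv'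
    subst hv'
    rcases conn_sdiff_or_conn_z (z := z) hvx with h | h
    · exact ⟨v', Finset.mem_singleton_self v', x, hx, h⟩
    · exact absurd ⟨x, hx, z, hzW, conn_trans (conn_symm hvx) h⟩ h4
  · rintro ⟨h1, h2, h3, h4⟩
    exact ⟨connSet_of_sdiff h1, connSet_of_sdiff h2, e3.not.2 h3, e4.not.2 h4⟩

/-- Cell `m`, `z` a `u`-vertex. -/
lemma mEv_reveal_A {A W : Finset V} (hzA : z ∈ A) (hzW : z ∉ W) :
    ω ∈ mEv ends U s t v A W ↔
      ω ∈ mEv ends (U \ {z}) s t v (A.erase z ∪ frontier ends U {z} ω) W := by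
  have hztW : z ∉ ({t} : Finset V) ∪ W := not_mem_union_of_ne hzt hzW
  have e3 : ConnSet ends (induced ends (↑U) ω) {s} ({t} ∪ A ∪ W) ↔
      ConnSet ends (induced ends (↑(U \ {z})) ω) {s}
        ({t} ∪ (A.erase z ∪ frontier ends U {z} ω) ∪ W) := by
    rw [connSet_reveal' hzU (by simpa using hzs)
      (Finset.mem_union_left _ (Finset.mem_union_right _ hzA)),
      erase_union_right hzW, erase_union_left (by simpa using hzt)]
  have e4 : ConnSet ends (induced ends (↑U) ω) ({t} ∪ W) A ↔
      ConnSet ends (induced ends (↑(U \ {z})) ω) ({t} ∪ W)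
        (A.erase z ∪ frontier ends U {z} ω) :=
    connSet_reveal' hzU hztW hzA
  constructor
  · rintro ⟨h1, h2, h3, h4⟩
    have htz : ¬ Conn ends (induced ends (↑U) ω) t z := fun h =>
      h4 ⟨t, Finset.mem_union_left _ (Finset.mem_singleton_self t), z, hzA, h⟩
    refine ⟨(connSet_sdiff_of_not_conn_z (z := z) fun x hx => by
        rw [Finset.mem_singleton] at hx; rw [hx]; exact htz).1 h1, ?_, e3.not.1 h3, e4.not.1 h4⟩
    obtain ⟨v', hv', x, hx, hvx⟩ := h2
    rw [Finset.mem_singleton] at hv'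
    subst hv'
    rcases conn_sdiff_or_conn_z (z := z) hvx with h | h
    · exact ⟨v', Finset.mem_singleton_self v', x, hx, h⟩
    · exact absurd ⟨x, hx, z, hzA, conn_trans (conn_symm hvx) h⟩ h4
  · rintro ⟨h1, h2, h3, h4⟩
    exact ⟨connSet_of_sdiff h1, connSet_of_sdiff h2, e3.not.2 h3, e4.not.2 h4⟩

/-- Cell `m`, `z` a `w`-vertex. -/
lemma mEv_reveal_W {A W : Finset V} (hzA : z ∉ A) (hzW : z ∈ W) :
    ω ∈ mEv ends U s t v A W ↔
      ω ∈ mEv ends (U \ {z}) s t v A (W.erase z ∪ frontier ends U {z} ω) := by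
  have hztA : z ∉ ({t} : Finset V) ∪ A := not_mem_union_of_ne hzt hzA
  have e1 : ConnSet ends (induced ends (↑U) ω) {t} W ↔
      ConnSet ends (induced ends (↑(U \ {z})) ω) {t} (W.erase z ∪ frontier ends U {z} ω) :=
    connSet_reveal' hzU (by simpa using hzt) hzW
  have e2 : ConnSet ends (induced ends (↑U) ω) {v} ({t} ∪ W) ↔
      ConnSet ends (induced ends (↑(U \ {z})) ω) {v}
        ({t} ∪ (W.erase z ∪ frontier ends U {z} ω)) := by
    rw [connSet_reveal' hzU (by simpa using hzv) (Finset.mem_union_right _ hzW),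
      erase_union_left (by simpa using hzt)]
  have e3 : ConnSet ends (induced ends (↑U) ω) {s} ({t} ∪ A ∪ W) ↔
      ConnSet ends (induced ends (↑(U \ {z})) ω) {s}
        ({t} ∪ A ∪ (W.erase z ∪ frontier ends U {z} ω)) := by
    rw [connSet_reveal' hzU (by simpa using hzs) (Finset.mem_union_right _ hzW),
      erase_union_left hztA]
  have e4 : ConnSet ends (induced ends (↑U) ω) ({t} ∪ W) A ↔
      ConnSet ends (induced ends (↑(U \ {z})) ω)
        ({t} ∪ (W.erase z ∪ frontier ends U {z} ω)) A := by
    rw [connSet_reveal hzU (Finset.mem_union_right _ hzW) hzA,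
      erase_union_left (by simpa using hzt)]
  constructor
  · rintro ⟨h1, h2, h3, h4⟩
    exact ⟨e1.1 h1, e2.1 h2, e3.not.1 h3, e4.not.1 h4⟩
  · rintro ⟨h1, h2, h3, h4⟩
    exact ⟨e1.2 h1, e2.2 h2, e3.not.2 h3, e4.not.2 h4⟩

end RevealCells

end BTVFamily

end Summit.Ventures.PercRepro2
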